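/-
Copyright (c) 2026 the pub-hodgecm-mathlib formalisation cell (harness21).  Prover seat hodgecm-mathlib-K2E5-p16 (g8): Track B «K2-LIT»,
hLiu418 = stmt-HodgeConjecture-24832; LEAD F0P6-plan (g14) BATCH #53 (2) «(E4) GK SPHERICAL VALUE n = 2, β = 0», cut (F-GK-1) (K2E5-p16 (g8) 16:28:52Z).
-/
import Summits.HodgeConjecture.HodgeConjecture.Theorems.K2LiuRankOneOperators   -- ★ B3 `integrable_and_integral_eq` (value at level `m`, reps `R`)
import HarnessLib

/-!
# Crux `HLiu418`, road `K2_Liu`, #41 KIND 0 (β) Euler face, brick (E4) «GK spherical value», file (F-GK-1):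
# THE SPHERICAL VALUE OF AN ABSTRACT RANK-ONE INTERTWINING OPERATOR — level `m = 0`, one representative

Cell `hodgecm-mathlib`, crux item hLiu418 = `stmt-HodgeConjecture-24832`; squad K2 ∕ K2Liu; prover K2E5-p16 (g8) (lead hand of (E4), LEAD F0P6-plan (g14)
BATCH #53 (2); desk K2Liu-p13 (g4) `CENSUS-Beta-EulerFace` §1 (E4)).  THEOREMS ONLY (no `def`, no instance, no notation, no named-fact hypothesis, no `sorry`);
lane `--supports stmt-HodgeConjecture-24832 --as helper` (count-neutral helper).  DEF-FREE and GROUP-ABSTRACT like ★ B3 `K2LiuRankOneOperators`: `G` is any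
group, the rank-one datum `(u, ū, w₀, ν, e, C₀)` is tied to `f : G → ℂ` by the one `SL₂` relation `hrel` and a right-`K′`-invariance.

THE POINT (Gindikin–Karpelevich at the spherical vector, one root at a time).  ★ B3 `integrable_and_integral_eq` evaluates `∫ f(w₀ u(x) y) dμ(x)` at a point `y`
of LEVEL `m` (`y⁻¹ u(𝔭^m) y, y⁻¹ ū(𝔭^m) y ⊆ K′`) through representatives of `𝔭^{−m} ⧸ 𝔭^m`.  At a SPHERICAL point — level `0`: `y⁻¹ u(𝒪) y ⊆ K′`,
`y⁻¹ ū(𝒪) y ⊆ K′` — the single representative `0` of `𝒪 ⧸ 𝒪` suffices, `u(0) = 1`, and if moreover `f(w₀ y) = f(y)` (e.g. `w₀, y ∈ K′`) the value is a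
closed form in `f(y)`:
* §1 `integrable_and_integral_eq_of_level_zero` — **`∫ f(w₀ u(x) y) dμ(x) = μ(𝒪) · (1 + C₀ (1 − q⁻¹) (α q^{1−e}) L(e − 1, ν)) · f(y)`**, `α = unramValue ν`
  (for ramified `ν`: `α = 0` and the value is `μ(𝒪) f(y)`);
* §2 `integral_eq_lFactor_div_lFactor_mul` — for `C₀ = 1`: **`∫ f(w₀ u(x) y) dμ(x) = μ(𝒪) · L(e − 1, ν) ∕ L(e, ν) · f(y)`**, the rank-one factor
  `c_α = L(e−1)∕L(e)` of the Gindikin–Karpelevich product (`(1 − αq^{1−e}) + (1 − q⁻¹) αq^{1−e} = 1 − αq^{−e}`).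
These are the three stage values of the cocycle `M_v(s) = A₂ A₁ A₂` (★ B4d-3 `K2LiuSiegelIntertwiningCocycle`) at the spherical Siegel section of `U(2,2)(F_v)`
at a good place, with `(ν, e) = (χ_{F,v}, 2s+2), (χ_F∘N_{E_w∕F_v}, 2s+1), (χ_{F,v}, 2s)` (★ B4d-1b, ★ B7-CB, ★ B7-CC∕B7-V): product
`L_F(2s+1)L_{E_w}(2s)L_F(2s−1) ∕ (L_F(2s+2)L_{E_w}(2s+1)L_F(2s))` = `aNum 2 ∕ bDen 2` of ★ T1 `K2LiuLocalLFactorDefs.aNorm_two` (file (F-GK-2)).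
HONEST LABEL.  `HC_CM` is proved only modulo the 7 printed citations (2 remaining named inputs: hLiu418 = `stmt-HodgeConjecture-24832`,
h413 = `stmt-HodgeConjecture-24833`) until rung 0 closes.

## References
* [Casselman1980] W. Casselman, *The unramified principal series of p-adic groups I*, Compositio Math. 40 (1980), §3 Thm. 3.1 (`T_α φ_K = c_α(χ) φ_K`,
  `c_α(χ) = (1 − q⁻¹ χ(a_α)) ∕ (1 − χ(a_α))`).
* [HarrisKudlaSweet1996] M. Harris, S. Kudla, W. J. Sweet, J. AMS 9 (1996), §6 (6.14)–(6.16).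
* [KudlaSweet1997] S. Kudla, W. J. Sweet, *Degenerate principal series representations for U(n,n)*, Israel J. Math. 98 (1997), §1.
* [Tate1950] J. Tate, *Fourier analysis in number fields and Hecke's zeta-functions* (1950), §2.5 (the local factor of an unramified character).
-/

set_option autoImplicit false
set_option linter.dupNamespace false -- the mandated namespace repeats `HodgeConjecture.HodgeConjecture`

noncomputable section

open MeasureTheory Filter Topology Set
open scoped NNReal ENNReal
open NumberField IsDedekindDomain
open Literature.NumberTheory.GaloisRepresentations.IsNonarchimedeanLocalField
open Literature.NumberTheory.Automorphic Literature.NumberTheory.Automorphic.LocalFieldHaar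
open Summit.HodgeConjecture.HodgeConjecture.Cruxes.HLiu418.K2LiuQRationalDefs
open Summit.HodgeConjecture.HodgeConjecture.Cruxes.HLiu418.K2LiuLocalLFactorDefs
open Summit.HodgeConjecture.HodgeConjecture.Cruxes.HLiu418.K2LiuQRationalLFactor
open Summit.HodgeConjecture.HodgeConjecture.Cruxes.HLiu418.K2LiuRankOneOperators

namespace Summit.HodgeConjecture.HodgeConjecture.Cruxes.HLiu418.K2LiuRankOneSphericalStage

variable {K : Type} [Field K] [NumberField K] {w : HeightOneSpectrum (𝓞 K)} {G : Type*} [Group G]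

/-! ## §1 The value at a point of level `0` -/

/-- an additive root letter has `u(0) = 1`. [cite: Casselman1980, §3] -/
theorem apply_zero_eq_one_of_add {u : w.adicCompletion K → G} (hu_add : ∀ x t, u (x + t) = u x * u t) : u 0 = 1 := by
  have h := hu_add 0 0
  rw [add_zero] at h
  exact left_eq_mul.mp h

/-- the ball `𝒪 = 𝔭⁰` is covered by the single class of `0` modulo `𝔭⁰` (the representatives `R = {0}` of ★ B3 at level `0`). [cite: Casselman1980, §3] -/
theorem primePowBall_zero_eq_biUnion_singleton :
    primePowBall (w.adicCompletion K) (-((0 : ℕ) : ℤ)) =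
      ⋃ a ∈ ({0} : Finset (w.adicCompletion K)), {x | x - a ∈ primePowBall (w.adicCompletion K) ((0 : ℕ) : ℤ)} := by
  ext x
  simp

/-- the algebra of the spherical value: `1 + (1 − q⁻¹)(αq^{1−e})L(e−1, ν) = L(e−1, ν) ∕ L(e, ν)` (`L(z, ν) = (1 − αq^{−z})⁻¹`, `re e > 1`, `‖α‖ ≤ 1`).
[cite: Casselman1980, §3 Thm. 3.1] [cite: Tate1950, §2.5] -/
theorem one_add_eq_lFactor_div_lFactor (ν : (w.adicCompletion K)ˣ →* ℂˣ) (hν : ∀ x, ‖((ν x : ℂˣ) : ℂ)‖ = 1) {e : ℂ} (he : 1 < e.re) :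
    1 + (1 - (residueFieldCard (w.adicCompletion K) : ℂ)⁻¹) *
          (unramValue K w ν * (residueFieldCard (w.adicCompletion K) : ℂ) ^ (1 - e)) * lFactor K w ν (e - 1) =
      lFactor K w ν (e - 1) / lFactor K w ν e := by
  have hq : (residueFieldCard (w.adicCompletion K) : ℂ) ≠ 0 := Nat.cast_ne_zero.2 (residueFieldCard_ne_zero _)
  have hL : lFactor K w ν (e - 1) ≠ 0 := lFactor_ne_zero (norm_unramValue_le_one hν) (by simp; linarith)
  have hden : 1 - unramValue K w ν * (residueFieldCard (w.adicCompletion K) : ℂ) ^ (-(e - 1)) ≠ 0 := by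
    intro h0; exact hL (by rw [lFactor_def, h0, inv_zero])
  have h1 : (residueFieldCard (w.adicCompletion K) : ℂ) ^ (1 - e) = (residueFieldCard (w.adicCompletion K) : ℂ) ^ (-(e - 1)) := by
    congr 1; ring
  have h2 : (residueFieldCard (w.adicCompletion K) : ℂ) ^ (-e) =
      (residueFieldCard (w.adicCompletion K) : ℂ)⁻¹ * (residueFieldCard (w.adicCompletion K) : ℂ) ^ (-(e - 1)) := by
    rw [← Complex.cpow_neg_one, ← Complex.cpow_add _ _ hq]; congr 1; ring
  rw [lFactor_def, lFactor_def, h1, h2]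
  field_simp
  ring

section Value

variable [MeasurableSpace (w.adicCompletion K)] [BorelSpace (w.adicCompletion K)]
  (μ : Measure (w.adicCompletion K)) [μ.IsAddHaarMeasure]

/-- **THE VALUE OF A RANK-ONE OPERATOR AT A POINT OF LEVEL `0` (the spherical Gindikin–Karpelevich step).**  For `f` right-`K′`-invariant with the `SL₂`
relation `f(w₀ u(x) g) = C₀ ν(x)⁻¹ ‖x‖^{−e} f(ū(x⁻¹) g)` (`ν` unitary, `re e > 1`), at a point `y` with `y⁻¹ u(𝒪) y ⊆ K′`, `y⁻¹ ū(𝒪) y ⊆ K′` and `f(w₀ y) = f(y)`: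
`x ↦ f(w₀ u(x) y)` is integrable and `∫ f(w₀ u(x) y) dμ(x) = μ(𝒪) · (1 + C₀ (1 − q⁻¹) (unramValue ν · q^{1−e}) L(e − 1, ν)) · f(y)`
(★ B3 `integrable_and_integral_eq` at `m = 0`, `R = {0}`). [cite: Casselman1980, §3 Thm. 3.1] [cite: Tate1950, §2.5] -/
theorem integrable_and_integral_eq_of_level_zero {f : G → ℂ} {K' : Subgroup G} (hfK : ∀ g, ∀ k ∈ K', f (g * k) = f g)
    {u ū : w.adicCompletion K → G} (hu_add : ∀ x t, u (x + t) = u x * u t) (w₀ : G)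
    (ν : (w.adicCompletion K)ˣ →* ℂˣ) (hν : ∀ x, ‖((ν x : ℂˣ) : ℂ)‖ = 1) (e C₀ : ℂ) (he : 1 < e.re)
    (hrel : ∀ (x : (w.adicCompletion K)ˣ) (g : G),
      f (w₀ * u x * g) = C₀ * (((ν x)⁻¹ : ℂˣ) : ℂ) * ((normAbs (w.adicCompletion K) (x : w.adicCompletion K) : ℝ) : ℂ) ^ (-e) *
        f (ū ((x⁻¹ : (w.adicCompletion K)ˣ) : w.adicCompletion K) * g))
    (y : G) (hmu : ∀ t ∈ primePowBall (w.adicCompletion K) 0, y⁻¹ * u t * y ∈ K')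
    (hmū : ∀ t ∈ primePowBall (w.adicCompletion K) 0, y⁻¹ * ū t * y ∈ K') (hw₀ : f (w₀ * y) = f y) :
    Integrable (fun x => f (w₀ * u x * y)) μ ∧
      ∫ x, f (w₀ * u x * y) ∂μ = (μ.real (primePowBall (w.adicCompletion K) 0) : ℂ) *
        (1 + C₀ * (1 - (residueFieldCard (w.adicCompletion K) : ℂ)⁻¹) *
          (unramValue K w ν * (residueFieldCard (w.adicCompletion K) : ℂ) ^ (1 - e)) * lFactor K w ν (e - 1)) * f y := by
  have h := integrable_and_integral_eq μ hfK hu_add w₀ ν hν e C₀ he hrel y 0 (by simpa using hmu) (by simpa using hmū)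
    ({0} : Finset (w.adicCompletion K)) (by simp) primePowBall_zero_eq_biUnion_singleton
  refine ⟨h.1, ?_⟩
  rw [h.2, Finset.sum_singleton, apply_zero_eq_one_of_add hu_add, mul_one, hw₀]
  push_cast
  ring

/-! ## §2 The Gindikin–Karpelevich factor `L(e − 1, ν) ∕ L(e, ν)` -/

/-- **THE SPHERICAL RANK-ONE FACTOR.**  Under the hypotheses of `integrable_and_integral_eq_of_level_zero` with `C₀ = 1`:
`∫ f(w₀ u(x) y) dμ(x) = μ(𝒪) · (L(e − 1, ν) ∕ L(e, ν)) · f(y)` — Casselman's `T_α φ_K(y) = c_α · φ_K(y)` for one root, with `c_α = L(e−1)∕L(e)`.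
[cite: Casselman1980, §3 Thm. 3.1] [cite: HarrisKudlaSweet1996, §6 (6.16)] [cite: KudlaSweet1997, §1] -/
theorem integral_eq_lFactor_div_lFactor_mul {f : G → ℂ} {K' : Subgroup G} (hfK : ∀ g, ∀ k ∈ K', f (g * k) = f g)
    {u ū : w.adicCompletion K → G} (hu_add : ∀ x t, u (x + t) = u x * u t) (w₀ : G)
    (ν : (w.adicCompletion K)ˣ →* ℂˣ) (hν : ∀ x, ‖((ν x : ℂˣ) : ℂ)‖ = 1) (e C₀ : ℂ) (he : 1 < e.re) (hC₀ : C₀ = 1)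
    (hrel : ∀ (x : (w.adicCompletion K)ˣ) (g : G),
      f (w₀ * u x * g) = C₀ * (((ν x)⁻¹ : ℂˣ) : ℂ) * ((normAbs (w.adicCompletion K) (x : w.adicCompletion K) : ℝ) : ℂ) ^ (-e) *
        f (ū ((x⁻¹ : (w.adicCompletion K)ˣ) : w.adicCompletion K) * g))
    (y : G) (hmu : ∀ t ∈ primePowBall (w.adicCompletion K) 0, y⁻¹ * u t * y ∈ K')
    (hmū : ∀ t ∈ primePowBall (w.adicCompletion K) 0, y⁻¹ * ū t * y ∈ K') (hw₀ : f (w₀ * y) = f y) :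
    ∫ x, f (w₀ * u x * y) ∂μ =
      (μ.real (primePowBall (w.adicCompletion K) 0) : ℂ) * (lFactor K w ν (e - 1) / lFactor K w ν e) * f y := by
  rw [(integrable_and_integral_eq_of_level_zero μ hfK hu_add w₀ ν hν e C₀ he hrel y hmu hmū hw₀).2, hC₀, one_mul,
    one_add_eq_lFactor_div_lFactor ν hν he]

end Value

end Summit.HodgeConjecture.HodgeConjecture.Cruxes.HLiu418.K2LiuRankOneSphericalStage

end
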